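import Summits.ResolutionOfSingularities.ResolutionOfSingularities.Theorems.WeightedInvariantContactCylinderEssSmooth
import Summits.ResolutionOfSingularities.ResolutionOfSingularities.Theorems.WeightedInvariantContactCylinderDescentStep
import Summits.ResolutionOfSingularities.ResolutionOfSingularities.Theorems.WeightedInvariantIota3TauStrat
import Literature.AlgebraicGeometry.Resolution.RegularLocalOrderValuation
import HarnessLib

/-!
# (c11)≤3 for the flat centre filtration `J₃ᵗ = Iota3.jFlatT`, PART 3 — LEMMA M: over a HEIGHT-TWO top `ι₀`-stratum the
# equation is NOT of monomial type at the generic point (door `HypersurfaceCentreConstruction`,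
# stmt-ResolutionOfSingularities-19897; P3 rung clause (c11)≤3; ORDER (o53) of res-L1-w43-plan-1, hand res-L1-w43-stub-3)

Topic: `Summits/ResolutionOfSingularities/ResolutionOfSingularities/Theorems`. Helper for the door item
`HypersurfaceCentreConstruction` (stmt-ResolutionOfSingularities-19897, route `WeightedInvariant`), line `local-engine`
(L W4.3), def-free.  MEMO `L/res-L1-w43-stub-3/g5/O53-MEMO.md` §2 (B).  The cylinder theorems of the line (brk-1/005's
`cylinder_comap_eq_weightedMonomialIdeal` p522408, `cylinder_map_compatible` p525507, `Descent.exists_pair_maximiser` p532512,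
PART 2's `cylinderAt_jContact_pair_map_compatible`) all carry the hypothesis «`f/1` is NOT of monomial type in `S_P`».  THIS
FILE discharges it from the stratification alone:

* `iotaOrd_unit_mul_pow` — `ord (v g^n) = n` in a regular local ring (`v` a unit, `g ∈ 𝔪 ∖ 𝔪²`; Literature
  `adicOrder_mul` / `adicOrder_pow`, the order is a valuation);
* `not_mem_sq_of_span_singleton_eq_maximalIdeal` — a non-zero generator of the maximal ideal of a local domain is not in `𝔪²`;
* **`not_isMonomialType_of_topStratumPrime_eq`** (LEMMA M) — `S` regular local of Krull dimension `≤ 3`, `0 ≠ f ∈ 𝔪_S`, the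
  generic prime `P₀ᵗ` of the top `ι₀`-stratum (`ι₀ = (ν ; ε ; τ)`, res-type-013's `topStratumPrime_iotaOrdEpsTau_spec`) equal
  to `(x, g₀)` for a pair with independent differentials ⇒ `f/1` is NOT of monomial type in `S_{(x, g₀)}`.  Otherwise
  `f/1 = v g^n` and the height-one prime `𝔮 = (g) ∩ S` keeps the stratifier: `ν = n` on both sides (valuation), `ε = τ = 0`
  at Krull dimension `≤ 2` on both sides (`iotaEps_eq_zero_of_ringKrullDim_le_two`, `iotaTau_eq_zero_of_ringKrullDim_le_two`;
  `(S_{P₀})_{(g)} ≅ S_𝔮`, Mathlib `localizationLocalizationAtPrimeIsoLocalization`, and (c6) `iotaOrdEpsTau_isoInvariant`), so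
  `P₀ ≤ 𝔮` by the spec; then `x/1, g₀/1 ∈ (g)` makes `𝔪_{S_{P₀}} = (x/1, g₀/1)` principal — `x/1 = a g` with `a` a unit puts
  `g₀/1 ∈ (x/1)`, with `a ∈ 𝔪` puts `x/1 ∈ 𝔪²`, against brk-1/005's `Descent.pair_facts`.

[OURS · L1 W4.3 · (o53)]  Replaces the role of NO printed item; NOT a statement of the manuscript
[claim: Hironaka2017, status: under-review]. AI work, weaker than expert review.  Pure commutative algebra; no named facts.

## References

* H. Matsumura, *Commutative Ring Theory* (1987), Thm. 4.3, 14.3, 16.2. [Matsumura1987]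
-/

noncomputable section

open IsLocalRing Literature.AlgebraicGeometry.Resolution
open Summit.ResolutionOfSingularities.ResolutionOfSingularities.Cruxes.HypersurfaceCentreConstruction.LocalEngine
open Summit.ResolutionOfSingularities.ResolutionOfSingularities.Cruxes.HypersurfaceCentreConstruction.LocalEngine.Iota3

set_option linter.dupNamespace false -- mandated namespace of this single-conjunct summit

namespace Summit.ResolutionOfSingularities.ResolutionOfSingularities.Theorems

namespace JFlatEssSmooth

open ContactCylinder

/-! ## Orders of `v · g^n` -/

/-- In a regular local ring `ord (v g^n) = n` for a unit `v` and `g ∈ 𝔪 ∖ 𝔪²` (the `𝔪`-adic order is a valuation,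
Literature `adicOrder_mul` / `adicOrder_pow`). [cite: Matsumura1987, Thm. 14.3] -/
theorem iotaOrd_unit_mul_pow (R : Type) [CommRing R] [IsRegularLocalRing R] {v g : R} (hv : IsUnit v)
    (hg : g ∈ maximalIdeal R) (hg2 : g ∉ maximalIdeal R ^ 2) (n : ℕ) : iotaOrd R (v * g ^ n) = (n : ℕ) := by
  have hg1 : adicOrder g = 1 := by
    refine le_antisymm ?_ ?_
    · exact (adicOrder_le_iff g 1).mpr hg2
    · exact (le_adicOrder_iff g 1).mpr (by rwa [pow_one])
  have hord : adicOrder (v * g ^ n) = n := by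
    rw [adicOrder_mul, adicOrder_pow, adicOrder_of_isUnit hv, hg1, zero_add, mul_one]
  rw [iotaOrd_eq_natCast_iff]
  exact ⟨(le_adicOrder_iff _ n).mp hord.ge, (adicOrder_le_iff _ n).mp hord.le⟩

/-- A generator of the maximal ideal of a local domain is not in its square (unless the ring is a field, excluded by
`g ≠ 0`). [folklore] -/
theorem not_mem_sq_of_span_singleton_eq_maximalIdeal (R : Type) [CommRing R] [IsLocalRing R] [IsDomain R] {g : R}
    (hg0 : g ≠ 0) (hmax : Ideal.span {g} = maximalIdeal R) : g ∉ maximalIdeal R ^ 2 := by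
  intro h
  rw [← hmax, Ideal.span_singleton_pow, Ideal.mem_span_singleton] at h
  obtain ⟨a, ha⟩ := h
  have h1 : g * (1 - g * a) = 0 := by rw [mul_sub, mul_one, ← mul_assoc, ← pow_two, ← ha, sub_self]
  rcases mul_eq_zero.mp h1 with h0 | h0
  · exact hg0 h0
  · have hga : g * a ∈ maximalIdeal R := by rw [← hmax]; exact Ideal.mul_mem_right _ _ (Ideal.mem_span_singleton_self g)
    exact (IsLocalRing.isUnit_one_sub_self_of_mem_nonunits (g * a) hga).ne_zero h0

/-! ## LEMMA M -/

/-- **LEMMA M.**  `S` regular local of Krull dimension `≤ 3`, `0 ≠ f ∈ 𝔪_S`, and the generic prime `P₀` of the top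
`ι₀`-stratum of `f` (`ι₀ = (ν ; ε ; τ)`) generated by a pair `(x, g₀)` with independent differentials (a height-two top
stratum: the P3a curve of a threefold germ, or the closed point of a surface germ).  Then `f/1` is NOT of monomial type in
`S_{P₀}`: otherwise `f/1 = v g^ν` there, and the height-one prime `𝔮 = (g) ∩ S ⊊ P₀` carries the same stratifier value as
`S` — `ν` by the valuation property of the order, `ε = τ = 0` at Krull dimension `≤ 2` on both sides
(`iotaEps_eq_zero_of_ringKrullDim_le_two`, `iotaTau_eq_zero_of_ringKrullDim_le_two`) — so `𝔮` lies on the top stratum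
`V(P₀)`, i.e. `P₀ ≤ 𝔮`, forcing `𝔪_{S_{P₀}} = (g)` principal, against the independent pair. [OURS · L1 W4.3 · (o53)] -/
theorem not_isMonomialType_of_topStratumPrime_eq {S : Type} [CommRing S] [IsRegularLocalRing S]
    (hdim : ringKrullDim S ≤ 3) {f : S} (hf0 : f ≠ 0) (hf : f ∈ maximalIdeal S) (x g₀ : S)
    (hxg : ∀ i, (![x, g₀] : Fin 2 → S) i ∈ maximalIdeal S)
    (hli : LinearIndependent (ResidueField S) (fun i => (maximalIdeal S).toCotangent ⟨(![x, g₀] : Fin 2 → S) i, hxg i⟩))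
    [(Ideal.span {x, g₀}).IsPrime] (hP : topStratumPrime iotaOrdEpsTau S f = Ideal.span {x, g₀}) :
    ¬ IsMonomialType (algebraMap S (Localization.AtPrime (Ideal.span {x, g₀})) f) := by
  intro hmono
  haveI hRP : IsRegularLocalRing (Localization.AtPrime (Ideal.span {x, g₀})) :=
    isRegularLocalRing_localization_atPrime S _
  haveI := isDomain_of_isRegularLocalRing (Localization.AtPrime (Ideal.span {x, g₀}))
  -- the order of `f` and the spec of the top stratum
  obtain ⟨-, hfν, hfν1⟩ := EssSmoothLevels.adicOrder_toNat_spec hf0 hf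
  have hν : iotaOrd S f = ((adicOrder f).toNat : ℕ) := (iotaOrd_eq_natCast_iff S f _).mpr ⟨hfν, hfν1⟩
  obtain ⟨_, -, hfP, -, hiff, -⟩ := topStratumPrime_iotaOrdEpsTau_spec hdim hf0 hf hν
  rw [hP] at hfP hiff
  -- pair facts at `S_P`
  obtain ⟨hmax, -, hx2, hg₀x⟩ := Descent.pair_facts (Ideal.span {x, g₀}) hxg hli rfl
  -- the monomial presentation `f/1 = v g^n`, `n ≥ 1`
  obtain ⟨v, g, n, hv, hg, hg2, hfeq⟩ := hmono
  have hfm : algebraMap S (Localization.AtPrime (Ideal.span {x, g₀})) f ∈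
      maximalIdeal (Localization.AtPrime (Ideal.span {x, g₀})) :=
    (IsLocalization.AtPrime.to_map_mem_maximal_iff (Localization.AtPrime (Ideal.span {x, g₀})) (Ideal.span {x, g₀}) f).mpr hfP
  have hn : 1 ≤ n := by
    rcases Nat.eq_zero_or_pos n with rfl | h
    · rw [pow_zero, mul_one] at hfeq
      rw [hfeq] at hfm
      exact absurd hfm (IsLocalRing.notMem_maximalIdeal.mpr hv)
    · exact h
  have hgprime : Prime g := IsRegularLocalRing.prime_of_not_mem_sq hg hg2
  have hg0 : g ≠ 0 := hgprime.ne_zero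
  haveI hQ : (Ideal.span {g}).IsPrime := (Ideal.span_singleton_prime hg0).mpr hgprime
  -- the contraction `𝔮 = (g) ∩ S`
  set 𝔮 : Ideal S := (Ideal.span {g}).comap (algebraMap S (Localization.AtPrime (Ideal.span {x, g₀}))) with h𝔮def
  haveI : 𝔮.IsPrime := Ideal.IsPrime.comap _
  have hf𝔮 : f ∈ 𝔮 := by
    rw [h𝔮def, Ideal.mem_comap, hfeq]
    exact Ideal.mul_mem_left _ v (Ideal.pow_mem_of_mem _ (Ideal.mem_span_singleton_self g) n hn)
  -- the second localisation `(S_P)_{(g)}` and `g/1` there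
  haveI : IsRegularLocalRing (Localization.AtPrime (Ideal.span {g})) :=
    isRegularLocalRing_localization_atPrime (Localization.AtPrime (Ideal.span {x, g₀})) _
  haveI := isDomain_of_isRegularLocalRing (Localization.AtPrime (Ideal.span {g}))
  have hmaxQ : Ideal.span {algebraMap (Localization.AtPrime (Ideal.span {x, g₀})) (Localization.AtPrime (Ideal.span {g})) g} =
      maximalIdeal (Localization.AtPrime (Ideal.span {g})) := by
    rw [← Localization.AtPrime.map_eq_maximalIdeal, Ideal.map_span, Set.image_singleton]
  have hg0' : algebraMap (Localization.AtPrime (Ideal.span {x, g₀})) (Localization.AtPrime (Ideal.span {g})) g ≠ 0 :=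
    fun h => hg0 (IsLocalization.injective (Localization.AtPrime (Ideal.span {g}))
      (Ideal.primeCompl_le_nonZeroDivisors (Ideal.span {g})) (by rw [h, map_zero]))
  have hgQ : algebraMap (Localization.AtPrime (Ideal.span {x, g₀})) (Localization.AtPrime (Ideal.span {g})) g ∈
      maximalIdeal (Localization.AtPrime (Ideal.span {g})) := by
    rw [← hmaxQ]; exact Ideal.mem_span_singleton_self _
  have hgQ2 := not_mem_sq_of_span_singleton_eq_maximalIdeal (Localization.AtPrime (Ideal.span {g})) hg0' hmaxQ
  -- dimensions
  have hdimP : ringKrullDim (Localization.AtPrime (Ideal.span {x, g₀})) ≤ 2 := ringKrullDim_atPrime_span_pair_le_two x g₀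
  have hdimQ : ringKrullDim (Localization.AtPrime (Ideal.span {g})) ≤ 2 :=
    (ringKrullDim_localization_atPrime_le (Ideal.span {g})).trans hdimP
  -- `ι₀` is kept at `𝔮`
  have hSP : iotaOrdEpsTau (Localization.AtPrime (Ideal.span {x, g₀}))
      (algebraMap S (Localization.AtPrime (Ideal.span {x, g₀})) f) = iotaOrdEpsTau S f := (hiff (Ideal.span {x, g₀}) hfP).mpr le_rfl
  have hfP0 : algebraMap S (Localization.AtPrime (Ideal.span {x, g₀})) f ≠ 0 := by
    rw [hfeq]; exact mul_ne_zero hv.ne_zero (pow_ne_zero n hg0)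
  have hfQ0 : algebraMap (Localization.AtPrime (Ideal.span {x, g₀})) (Localization.AtPrime (Ideal.span {g}))
      (algebraMap S (Localization.AtPrime (Ideal.span {x, g₀})) f) ≠ 0 := by
    rw [hfeq, map_mul, map_pow]
    exact mul_ne_zero (hv.map _).ne_zero (pow_ne_zero n hg0')
  have hfQm : algebraMap (Localization.AtPrime (Ideal.span {x, g₀})) (Localization.AtPrime (Ideal.span {g}))
      (algebraMap S (Localization.AtPrime (Ideal.span {x, g₀})) f) ∈ maximalIdeal (Localization.AtPrime (Ideal.span {g})) := by
    rw [hfeq, map_mul, map_pow]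
    exact Ideal.mul_mem_left _ _ (Ideal.pow_mem_of_mem _ hgQ n hn)
  have hQP : iotaOrdEpsTau (Localization.AtPrime (Ideal.span {g}))
      (algebraMap (Localization.AtPrime (Ideal.span {x, g₀})) (Localization.AtPrime (Ideal.span {g}))
        (algebraMap S (Localization.AtPrime (Ideal.span {x, g₀})) f)) =
      iotaOrdEpsTau (Localization.AtPrime (Ideal.span {x, g₀})) (algebraMap S (Localization.AtPrime (Ideal.span {x, g₀})) f) := by
    rw [iotaOrdEpsTau_eq_iff, iotaOrdEps_eq_iff]
    refine ⟨⟨?_, ?_⟩, ?_⟩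
    · rw [hfeq, map_mul, map_pow, iotaOrd_unit_mul_pow _ (hv.map _) hgQ hgQ2 n, iotaOrd_unit_mul_pow _ hv hg hg2 n]
    · rw [iotaEps_eq_zero_of_ringKrullDim_le_two hdimQ hfQ0 hfQm, iotaEps_eq_zero_of_ringKrullDim_le_two hdimP hfP0 hfm]
    · rw [iotaTau_eq_zero_of_ringKrullDim_le_two hdimQ, iotaTau_eq_zero_of_ringKrullDim_le_two hdimP]
  have key : iotaOrdEpsTau (Localization.AtPrime 𝔮) (algebraMap S (Localization.AtPrime 𝔮) f) = iotaOrdEpsTau S f := by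
    let e : Localization.AtPrime 𝔮 ≃ₐ[S] Localization.AtPrime (Ideal.span {g}) :=
      IsLocalization.localizationLocalizationAtPrimeIsoLocalization (Ideal.span {x, g₀}).primeCompl (Ideal.span {g})
    have h1 : algebraMap (Localization.AtPrime (Ideal.span {x, g₀})) (Localization.AtPrime (Ideal.span {g}))
        (algebraMap S (Localization.AtPrime (Ideal.span {x, g₀})) f) = algebraMap S (Localization.AtPrime (Ideal.span {g})) f :=
      (IsScalarTower.algebraMap_apply S _ _ f).symm
    have h2 : e (algebraMap S (Localization.AtPrime 𝔮) f) = algebraMap S (Localization.AtPrime (Ideal.span {g})) f := e.commutes f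
    rw [← hSP, ← hQP, h1, ← h2]
    exact (iotaOrdEpsTau_isoInvariant _ _ e.toRingEquiv _).symm
  have hle : Ideal.span {x, g₀} ≤ 𝔮 := (hiff 𝔮 hf𝔮).mp key
  -- `x/1, g₀/1 ∈ (g)`: the maximal ideal of `S_P` would be principal
  have hxQ : algebraMap S (Localization.AtPrime (Ideal.span {x, g₀})) x ∈ Ideal.span {g} :=
    Ideal.mem_comap.mp (hle (Ideal.subset_span (by simp)))
  have hg₀Q : algebraMap S (Localization.AtPrime (Ideal.span {x, g₀})) g₀ ∈ Ideal.span {g} :=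
    Ideal.mem_comap.mp (hle (Ideal.subset_span (by simp)))
  obtain ⟨a, ha⟩ := Ideal.mem_span_singleton'.mp hxQ
  by_cases hau : IsUnit a
  · -- `(x/1) = (g) ∋ g₀/1`
    apply hg₀x
    rw [← ha, Ideal.span_singleton_mul_left_unit hau]
    exact hg₀Q
  · -- `a ∈ 𝔪`, so `x/1 = a g ∈ 𝔪²`
    apply hx2
    rw [← ha, pow_two]
    exact Ideal.mul_mem_mul ((IsLocalRing.mem_maximalIdeal a).mpr hau) hg

end JFlatEssSmooth

end Summit.ResolutionOfSingularities.ResolutionOfSingularities.Theorems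

end
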